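import Summits.PneNP.PneNP.Theorems.SliceACZero.Negative.SliceIndistVariants

/-!
# Negative lemmas for crux `SliceACZero` (stmt-PneNP-2835), Part VII-D: the rate in the lines' C⁺ cannot
beat `1/(8j)` — already for one `∧₂`-gate

The lines prove `SliceIndist` with rate `polylog(size)/√j`; the idea card `analytic-depoissonization`
claims `polylog/j`. This file certifies the floor: on `ι = Fin (2j)` the one-gate circuit `x₀ ∧ x₁`
(`acBasis`, `acDepth 1`, size `1`) has

  `E_{μ_{1/2}}[x₀ ∧ x₁] − a_j(x₀ ∧ x₁) = 1/4 − C(2j−2, j−2)/C(2j, j) = 1/(4(2j−1))`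

(`sliceIndist_gap_and2`, stated with `j = a + 2`), hence the C⁺ is FALSE with any rate `o(1/j)`, even
restricted to depth `1` and size `1` (`not_sliceIndist_rate_o_inv`). So `Θ̃(1/j)` is the true order of the
slice/product gap for small bounded-depth circuits, and the lines' `1/√j` is loose by exactly `√j`
(harmless for the crux, which needs only `o(1)`). Vocabulary from `SliceIndistVariants.lean`.
Sorry-free, standard axioms; no Theses decl asserted positively. Refuter seat cdisprove-stmt-PneNP-2835
(gen 2), 2026-08-16.
-/

noncomputable section

namespace Summit.PneNP.PneNP.Theorems.SliceACZero.Negative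

open Literature.Computability.Complexity Filter Finset

/-! ### Splitting off the first two coordinates of `Fin (M+2) → Bool` -/

/-- Drop the first two coordinates. [folklore] -/
def tail2 {M : ℕ} (x : Fin (M + 2) → Bool) : Fin M → Bool := fun i => x i.succ.succ

/-- Prepend two coordinates. [folklore] -/
def cons2 {M : ℕ} (a b : Bool) (y : Fin M → Bool) : Fin (M + 2) → Bool := Fin.cons a (Fin.cons b y)

/-- `cons2`/`tail2` bookkeeping. [folklore] -/
theorem cons2_zero {M : ℕ} (a b : Bool) (y : Fin M → Bool) : cons2 a b y 0 = a := rfl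

/-- `cons2`/`tail2` bookkeeping. [folklore] -/
theorem cons2_one {M : ℕ} (a b : Bool) (y : Fin M → Bool) : cons2 a b y 1 = b := rfl

/-- `cons2`/`tail2` bookkeeping. [folklore] -/
theorem tail2_cons2 {M : ℕ} (a b : Bool) (y : Fin M → Bool) : tail2 (cons2 a b y) = y := rfl

/-- `cons2`/`tail2` bookkeeping. [folklore] -/
theorem cons2_tail2 {M : ℕ} (x : Fin (M + 2) → Bool) : cons2 (x 0) (x 1) (tail2 x) = x := by
  funext i
  refine Fin.cases rfl (fun i => ?_) i
  refine Fin.cases rfl (fun i => ?_) i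
  rfl

/-- The weight splits over the first two coordinates. [folklore] -/
theorem wt_eq_tail2 {M : ℕ} (x : Fin (M + 2) → Bool) :
    wt x = (x 0).toNat + (x 1).toNat + wt (tail2 x) := by
  have key : ∀ b : Bool, (if b = true then 1 else 0) = b.toNat := fun b => by cases b <;> rfl
  simp only [wt, Finset.card_filter, Fin.sum_univ_succ, Fin.succ_zero_eq_one, tail2, key]
  ring

/-- **Points of weight `m+2` with the first two coordinates on** correspond to points of weight `m` on the
remaining `M` coordinates: there are `C(M, m)` of them. [folklore] -/
theorem card_filter_two_on_wt {M : ℕ} (m : ℕ) :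
    #(univ.filter fun x : Fin (M + 2) → Bool => x 0 = true ∧ x 1 = true ∧ wt x = m + 2) = M.choose m := by
  rw [← Fintype.card_fin M, ← card_filter_wt_eq (ι := Fin M) m, Fintype.card_fin]
  refine Finset.card_nbij' tail2 (cons2 true true) ?_ ?_ ?_ ?_
  · intro x hx
    rw [Finset.mem_coe, Finset.mem_filter] at hx ⊢
    obtain ⟨-, h0, h1, hw⟩ := hx
    refine ⟨Finset.mem_univ _, ?_⟩
    have := wt_eq_tail2 x
    rw [h0, h1, Bool.toNat_true] at this
    omega
  · intro y hy
    rw [Finset.mem_coe, Finset.mem_filter] at hy ⊢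
    refine ⟨Finset.mem_univ _, rfl, rfl, ?_⟩
    rw [wt_eq_tail2, cons2_zero, cons2_one, tail2_cons2, Bool.toNat_true, hy.2]
    omega
  · intro x hx
    rw [Finset.mem_coe, Finset.mem_filter] at hx
    have := cons2_tail2 x
    rw [hx.2.1, hx.2.2.1] at this
    exact this
  · intro y _
    exact tail2_cons2 true true y

/-- **Points with the first two coordinates on**: `2^M` of them. [folklore] -/
theorem card_filter_two_on {M : ℕ} :
    #(univ.filter fun x : Fin (M + 2) → Bool => x 0 = true ∧ x 1 = true) = 2 ^ M := by
  have huniv : #(univ : Finset (Fin M → Bool)) = 2 ^ M := by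
    rw [Finset.card_univ, Fintype.card_fun, Fintype.card_bool, Fintype.card_fin]
  rw [← huniv]
  refine Finset.card_nbij' tail2 (cons2 true true) ?_ ?_ ?_ ?_
  · intro x _
    exact Finset.mem_coe.2 (Finset.mem_univ _)
  · intro y _
    rw [Finset.mem_coe, Finset.mem_filter]
    exact ⟨Finset.mem_univ _, rfl, rfl⟩
  · intro x hx
    rw [Finset.mem_coe, Finset.mem_filter] at hx
    have := cons2_tail2 x
    rw [hx.2.1, hx.2.2] at this
    exact this
  · intro y _
    exact tail2_cons2 true true y

/-! ### The one-gate witness `x₀ ∧ x₁` -/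

/-- **One `∧₂`-gate**: a circuit over `acBasis` of `acDepth ≤ 1` and size `≤ 1` computing `x₀ ∧ x₁` on
`Fin (M+2)`. [folklore] -/
theorem exists_and2_circuit (M : ℕ) :
    ∃ C : Circuit (Fin (M + 2)), C.IsOver acBasis ∧ C.acDepth ≤ 1 ∧ C.size ≤ 1 ∧
      ∀ x, C.eval x = (x 0 && x 1) := by
  have h : ACReal (fun x : Fin (M + 2) → Bool => x 0 && x 1) (0 + 1) (0 + 0 + 1) :=
    acReal_and (acReal_input 0) (acReal_input 1)
  obtain ⟨C, hB, hd, hs, he⟩ := h.toCircuit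
  exact ⟨C, hB, hd, hs, he⟩

/-- The central binomial ratio: `(a+2)(a+1)·C(2a+4, a+2) = (2a+4)(2a+3)·C(2a+2, a)`. [folklore] -/
theorem choose_central_ratio (a : ℕ) :
    (a + 2) * (a + 1) * (2 * a + 4).choose (a + 2) = (2 * a + 4) * (2 * a + 3) * (2 * a + 2).choose a := by
  have h1 := Nat.add_one_mul_choose_eq (2 * a + 3) (a + 1)
  -- (2a+4) C(2a+3, a+1) = C(2a+4, a+2) (a+2)
  have h2 := Nat.add_one_mul_choose_eq (2 * a + 2) a
  -- (2a+3) C(2a+2, a) = C(2a+3, a+1) (a+1)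
  have e1 : 2 * a + 3 + 1 = 2 * a + 4 := by ring
  have e2 : 2 * a + 2 + 1 = 2 * a + 3 := by ring
  rw [e1] at h1
  rw [e2] at h2
  calc (a + 2) * (a + 1) * (2 * a + 4).choose (a + 2)
      = ((2 * a + 4).choose (a + 1 + 1) * (a + 1 + 1)) * (a + 1) := by ring_nf
    _ = ((2 * a + 4) * (2 * a + 3).choose (a + 1)) * (a + 1) := by rw [← h1]
    _ = (2 * a + 4) * ((2 * a + 3).choose (a + 1) * (a + 1)) := by ring
    _ = (2 * a + 4) * ((2 * a + 3) * (2 * a + 2).choose a) := by rw [← h2]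
    _ = (2 * a + 4) * (2 * a + 3) * (2 * a + 2).choose a := by ring

/-- **The slice/product gap of `x₀ ∧ x₁` on `Fin (2j)` at the middle slice is exactly `1/(4(2j−1))`**
(`j = a + 2`): `E_{μ_{1/2}} = 1/4`, `a_j = C(2j−2, j−2)/C(2j, j) = (j−1)/(2(2j−1))`. [folklore] -/
theorem sliceIndist_gap_and2 (a : ℕ) {C : Circuit (Fin (2 * a + 2 + 2))} (hC : ∀ x, C.eval x = (x 0 && x 1)) :
    prodAvg (((a + 2 : ℕ) : ℝ) / (Fintype.card (Fin (2 * a + 2 + 2)) : ℝ)) C.eval - sliceAvg C.eval (a + 2) =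
      1 / (4 * (2 * (a : ℝ) + 3)) := by
  have hfilter : (univ.filter fun x : Fin (2 * a + 2 + 2) → Bool => C.eval x = true) =
      univ.filter fun x => x 0 = true ∧ x 1 = true := by
    ext x
    simp [hC, Bool.and_eq_true]
  -- the product side: 2^M · (1/2)^{M+2} = 1/4
  have hq : ((a + 2 : ℕ) : ℝ) / (Fintype.card (Fin (2 * a + 2 + 2)) : ℝ) = 1 / 2 := by
    rw [Fintype.card_fin]
    push_cast
    have : (0 : ℝ) < 2 * (a : ℝ) + 2 + 2 := by positivity
    field_simp
    ring
  have hprod : prodAvg (((a + 2 : ℕ) : ℝ) / (Fintype.card (Fin (2 * a + 2 + 2)) : ℝ)) C.eval = 1 / 4 := by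
    rw [hq]
    unfold prodAvg
    rw [hfilter]
    have hterm : ∀ x ∈ (univ.filter fun x : Fin (2 * a + 2 + 2) → Bool => x 0 = true ∧ x 1 = true),
        prodWeight (1 / 2 : ℝ) x = (1 / 2 : ℝ) ^ (2 * a + 2 + 2) := by
      intro x _
      unfold prodWeight
      rw [show (1 : ℝ) - 1 / 2 = 1 / 2 by norm_num, ← pow_add, Fintype.card_fin,
        Nat.add_sub_cancel' ((wt_le_card x).trans (by rw [Fintype.card_fin]))]
    rw [Finset.sum_congr rfl hterm, Finset.sum_const, card_filter_two_on, nsmul_eq_mul]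
    push_cast
    rw [pow_add, one_div_pow]
    have h2 : (2 : ℝ) ^ (2 * a + 2) ≠ 0 := by positivity
    field_simp
    ring
  -- the slice side: C(2a+2, a)/C(2a+4, a+2)
  have hslice : sliceAvg C.eval (a + 2) =
      (((2 * a + 2).choose a : ℕ) : ℝ) / (((2 * a + 2 + 2).choose (a + 2) : ℕ) : ℝ) := by
    unfold sliceAvg
    rw [card_filter_wt_eq, Fintype.card_fin]
    have hnum : (univ.filter fun x : Fin (2 * a + 2 + 2) → Bool => wt x = a + 2 ∧ C.eval x = true) =
        univ.filter fun x => x 0 = true ∧ x 1 = true ∧ wt x = a + 2 := by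
      ext x
      simp only [Finset.mem_filter, Finset.mem_univ, true_and, hC, Bool.and_eq_true]
      tauto
    rw [hnum, card_filter_two_on_wt]
  rw [hprod, hslice]
  have hratio := choose_central_ratio a
  have hc4 : (0 : ℝ) < (((2 * a + 2 + 2).choose (a + 2) : ℕ) : ℝ) := by
    exact_mod_cast Nat.choose_pos (by omega)
  have hratio' : ((a : ℝ) + 2) * ((a : ℝ) + 1) * (((2 * a + 2 + 2).choose (a + 2) : ℕ) : ℝ) =
      (2 * (a : ℝ) + 4) * (2 * (a : ℝ) + 3) * (((2 * a + 2).choose a : ℕ) : ℝ) := by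
    have e : 2 * a + 2 + 2 = 2 * a + 4 := by ring
    rw [e]
    exact_mod_cast hratio
  have hkey : ((a : ℝ) + 1) * (((2 * a + 2 + 2).choose (a + 2) : ℕ) : ℝ) =
      2 * (2 * (a : ℝ) + 3) * (((2 * a + 2).choose a : ℕ) : ℝ) := by
    apply mul_left_cancel₀ (show ((a : ℝ) + 2) ≠ 0 by positivity)
    linear_combination hratio'
  rw [div_sub_div _ _ (by norm_num) hc4.ne', div_eq_div_iff (by positivity) (by positivity)]
  linear_combination 8 * hkey

/-- **The lines' C⁺ is FALSE with any rate `o(1/j)`**, already for depth `1` and size `1`: by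
`sliceIndist_gap_and2` the gap of `x₀ ∧ x₁` at `N = 2j` is `1/(4(2j−1)) ≥ 1/(8j)`. [folklore] -/
theorem not_sliceIndist_rate_o_inv :
    ¬ (∀ ε : ℝ, 0 < ε → ∃ j₀ : ℕ, ∀ (ι : Type) [Fintype ι] [DecidableEq ι] (j : ℕ),
        j₀ ≤ j → 2 * j ≤ Fintype.card ι →
          ∀ C : Circuit ι, C.IsOver acBasis → C.acDepth ≤ 1 → C.size ≤ 1 →
            |prodAvg ((j : ℝ) / (Fintype.card ι : ℝ)) C.eval - sliceAvg C.eval j| ≤ ε / j) := by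
  intro h
  obtain ⟨j₀, hj₀⟩ := h (1 / 16) (by norm_num)
  obtain ⟨C, hB, hd, hs, he⟩ := exists_and2_circuit (2 * j₀ + 2)
  have key := hj₀ (Fin (2 * j₀ + 2 + 2)) (j₀ + 2) (by omega) (by simp; omega) C hB hd hs
  rw [sliceIndist_gap_and2 j₀ he, abs_of_pos (by positivity)] at key
  -- 1/(4(2j₀+3)) ≤ (1/16)/(j₀+2) is false
  have hj : (0 : ℝ) ≤ j₀ := Nat.cast_nonneg _
  rw [div_le_div_iff₀ (by positivity) (by positivity)] at key
  push_cast at key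
  nlinarith

end Summit.PneNP.PneNP.Theorems.SliceACZero.Negative

end
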